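import Summits.QuantumFields.QCD.Theses.MultibosonBridge

/-!
# Line `multiboson-split` for the crux `FullLatticeGapC` (stmt-QuantumFields-17619)
# — the strategist's BC2-redirect decomposition, one level further down

`FullLatticeGapC` (the chirally pinned lattice half) is, in route `MultibosonBridge`, the OUTPUT of
its two genuine cruxes `MultibosonLatticeGapR4` (stmt-17617, the construction) and `GapTransferR3`
(stmt-11439, the transfer): glue `fullLatticeGapC_of_subs` (Theorems file
`MultibosonBridgeFullLatticeGapCSplit.lean`, reproduced below as `fullLatticeGapC_of_pieces` so that
this skeleton elaborates on its own). This line registers a PLAN FOR BOTH PIECES: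

* piece `MultibosonLatticeGapR4` ⇐ `stub_chiralDiluteLine` (S1: an asymptotically scaling,
  mass-scaling regularisation pinned to the chiral critical line FROM THE MASSIVE SIDE — the
  subsequence-stable chiral clause — carrying, at every positive mass tuple, tied admissible
  multiboson data whose spectral tail is dilute under the bosonised measure; light-quark Wilson
  spectral physics, NO gap / confinement content) and `stub_gapOfDiluteTail` (S2: along EVERY
  mass-scaling, asymptotically scaling regularisation, at every positive mass tuple on the physical
  branch, tied admissible data with a dilute spectral tail force a volume-uniform lattice gap of the
  POSITIVE-weight bosonised `SU(3)` gauge–Higgs marginal; the confinement / Yang–Mills-type content,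
  with no chiral tuning — it is universally quantified over regularisations and data, the dilute
  tail being the intrinsic certificate "massive side, artefacts rare" that excludes Aoki-phase and
  critical witnesses, while parked witnesses reduce it to the `SU(3)` lattice Yang–Mills gap with
  heavy multiplets);
* piece `GapTransferR3` ⇐ `stub_seaTransfer` (T1: the R-reweighting alone — bosonised gap + tied
  admissible data + dilute tail ⇒ QCD's signed-measure gap for QUARK-FREE (purely gluonic)
  gauge-invariant local observables; no Wick contraction enters) and `stub_valenceLines` (T2: the
  gluonic signed-QCD gap + dilute tail ⇒ the gap for ALL gauge-invariant local observables —
  mesons, baryons: massive valence quark lines, i.e. volume-uniform decay of Wick-contracted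
  polynomial / adjugate propagators despite exceptional configurations at supercritical hopping).

Composition: `multibosonLatticeGapR4_of_stubs`, `gapTransferR3_of_stubs`, and `FullLatticeGapC_of` concluding
`Summit.QuantumFields.QCD.Theses.MultibosonBridge.FullLatticeGapC` BY NAME. Sorries only inside the
four `stub_*`.
-/

namespace Summit.QuantumFields.QCD.Cruxes.FullLatticeGapC.MultibosonSplit

open Literature.MathematicalPhysics.QuantumFieldTheory
open Summit.QuantumFields.QCD.Theses.MultibosonBridge (MultibosonLatticeGapR4 GapTransferR3
  FullLatticeGapC)
open Filter

/-- **S1 — the chiral dilute line (piece `MultibosonLatticeGapR4`, stub 1 of 2).** For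
`N_f ∈ {2, 3}` there is ONE mass-independent regularisation with leading-log mass scaling, two-loop
asymptotic scaling and the subsequence-stable chiral clause (for every `ε > 0` some positive mass
tuple has, eventually in `k`, a connected correlator beating every `C e^{−ε a_k n}` — the pion is
lighter than `ε`), such that at every positive mass tuple the bare masses are eventually on the
physical branch and there are TIED admissible multiboson data (`IsAdmissibleMultibosonDataR`,
`δ_k / a_k² → 0`) whose spectral tail is dilute under the bosonised measure
(`HasSpectralTailDomination`). No gap is asserted: this is the existence of the honest critical
line approached from the massive side, certified intrinsically by tail-diluteness (which fails
inside the Aoki phase and at criticality, where `ρ_H(0) ≠ 0`, and holds trivially for parked heavy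
masses — but those violate the chiral clause). Why plausible: GMOR `m_π² ≈ 2Bm` on the massive side
of `κ_c(β)` (Sharpe–Singleton scenario analysis), and at bare subtracted mass `a m_q > 0` the band
`|t| ≤ a m_q / 2.2` of `γ₅ D_W` is populated only by lattice artefacts whose density vanishes
towards the continuum (Edwards–Heller–Narayanan 1999), suppressed further by `W ≈ κ^N |det H|`.
Size: L (open). -/
theorem stub_chiralDiluteLine :
    ∀ Nf : ℕ, Nf = 2 ∨ Nf = 3 → ∃ reg : QCDRegularisation Nf, reg.HasMassScaling ∧
      (reg.scheme 0 0 0).HasAsymptoticScaling ∧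
      (∀ ε : ℝ, 0 < ε → ∃ m : Fin Nf → ℝ, (∀ f, 0 < m f) ∧
        ∃ (R R' : ℕ) (A : QCDLatticeObservable Nf R) (B : QCDLatticeObservable Nf R'),
          ∀ C : ℝ, ∀ᶠ k in atTop, ∃ S : ℕ, (reg.scheme m 0 0).L k ≤ S ∧ ∃ n : ℕ, n ≤ S ∧
            C * Real.exp (-(ε * ((reg.scheme m 0 0).a k * n))) <
              ‖qcdLatticeConnectedCorr ((reg.scheme m 0 0).β k) (2 * S + 1)
                (fun fl => (reg.scheme m 0 0).mq fl k) A B n‖) ∧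
      ∀ m : Fin Nf → ℝ, (∀ f, 0 < m f) →
        (∀ f, ∀ᶠ k in atTop, -1 < (reg.scheme m 0 0).mq f k) ∧
        ∃ (ε δ p : ℕ → ℝ) (ℓ : ℕ → ℕ) (κ : ℕ → Fin Nf → ℝ) (ν : ℕ → Fin Nf → List ℂ),
          IsAdmissibleMultibosonDataR (reg.scheme m 0 0) ε δ ℓ κ ν ∧
          Tendsto (fun k => δ k / reg.a k ^ 2) atTop (nhds 0) ∧
          HasSpectralTailDomination (reg.scheme m 0 0) ε p ℓ ν := by
  sorry

/-- **S2 — gap of the dilute-tailed bosonised theory (piece `MultibosonLatticeGapR4`, stub 2 of 2).**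
Along EVERY regularisation with mass scaling and asymptotic scaling (`N_f ∈ {2,3}`), at every
positive mass tuple eventually on the physical branch, and for EVERY tied admissible multiboson data
with a dilute spectral tail, the bosonised `SU(3)` gauge–Higgs marginal (`multibosonExpect`, weight
`W = ∏_f ∏_z |det(γ₅ D_W(m_f(k)) − z)|⁻² > 0`) has a volume-uniform lattice gap `Δ > 0`
(`HasMultibosonLatticeGap`). Universally quantified: the dilute tail is the intrinsic "massive side"
certificate (Aoki-phase / critical witnesses have `ρ_H(0) ≠ 0` and fail it; quenched data `ν = []`,
`ε ≡ 1` fail it since every vector is then a quasi-mode), so no chiral tuning enters; on parked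
(cutoff-heavy) regularisations the tail is empty by coercivity and S2 reduces to the `SU(3)` lattice
Yang–Mills gap with heavy positive-weight multiplets — S2 is at least that hard
(`PerturbativeInvisibility` conceded, as for the crux). Why plausible: positive-weight gauge–Higgs
systems are the constructive corner with probabilistic tools (Osterwalder–Seiler 1978; Bałaban's
block RG with exact Gaussian integration of the multiplets), and a dilute tail removes the only
light non-gluonic excitation besides the massive pion. Size: XL (open; Yang–Mills-hard). -/
theorem stub_gapOfDiluteTail :
    ∀ (Nf : ℕ) (reg : QCDRegularisation Nf) (m : Fin Nf → ℝ) (ε δ p : ℕ → ℝ) (ℓ : ℕ → ℕ)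
      (κ : ℕ → Fin Nf → ℝ) (ν : ℕ → Fin Nf → List ℂ),
      Nf = 2 ∨ Nf = 3 → reg.HasMassScaling → (reg.scheme 0 0 0).HasAsymptoticScaling →
      (∀ f, 0 < m f) → (∀ f, ∀ᶠ k in atTop, -1 < (reg.scheme m 0 0).mq f k) →
      IsAdmissibleMultibosonDataR (reg.scheme m 0 0) ε δ ℓ κ ν →
      Tendsto (fun k => δ k / reg.a k ^ 2) atTop (nhds 0) →
      HasSpectralTailDomination (reg.scheme m 0 0) ε p ℓ ν →
      ∃ Δ > 0, (reg.scheme m 0 0).HasMultibosonLatticeGap ν Δ := by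
  sorry

/-- **T1 — sea transfer (piece `GapTransferR3`, stub 1 of 2).** Along `reg.scheme m 0 0`
(`N_f ∈ {2,3}`, mass scaling, asymptotic scaling, `m > 0`, physical branch), tied admissible data
with a dilute tail and a bosonised gap `Δ > 0` give, for some `Δ' ∈ (0, Δ]`, volume-uniform
exponential decay at rate `Δ'` of the SIGNED lattice-QCD connected correlations of every pair of
QUARK-FREE gauge-invariant local observables (`A.F U = g(U)·1`: Wilson loops, plaquette
polynomials). Mechanism: for gluonic `a, b` one has `⟨a b⟩_QCD = E^bos[a b R] / E^bos[R]` exactly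
(`ReweightingIdentity`, no Wick contraction), with `R = ∏_f ∏_i λ_{f,i} q_f(λ_{f,i})` = a
`δ_k`-small strictly local bulk factor (IR-irrelevant by the rate tie) × a dilute repulsive defect
gas (the tail); transfer the gap through this reweighting. Why it might fail: `log R` is extensive
with physical range growing like `log(1/a_k)·Z_m(k)/m`, so a single-scale cluster expansion gives
`Δ'_k → 0`; covariance decay of `μ^bos` is weak mixing only (`d > 2`); sign of `E^bos[R]` at
`N_f = 3`. Size: XL. -/
theorem stub_seaTransfer :
    ∀ (Nf : ℕ) (reg : QCDRegularisation Nf) (m : Fin Nf → ℝ) (ε δ p : ℕ → ℝ) (ℓ : ℕ → ℕ)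
      (κ : ℕ → Fin Nf → ℝ) (ν : ℕ → Fin Nf → List ℂ) (Δ : ℝ),
      Nf = 2 ∨ Nf = 3 → reg.HasMassScaling → (reg.scheme 0 0 0).HasAsymptoticScaling →
      (∀ f, 0 < m f) → (∀ f, ∀ᶠ k in atTop, -1 < (reg.scheme m 0 0).mq f k) →
      IsAdmissibleMultibosonDataR (reg.scheme m 0 0) ε δ ℓ κ ν →
      Tendsto (fun k => δ k / reg.a k ^ 2) atTop (nhds 0) →
      HasSpectralTailDomination (reg.scheme m 0 0) ε p ℓ ν → 0 < Δ →
      (reg.scheme m 0 0).HasMultibosonLatticeGap ν Δ →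
      ∃ Δ' : ℝ, 0 < Δ' ∧ Δ' ≤ Δ ∧
        ∀ (R R' : ℕ) (A : QCDLatticeObservable Nf R) (B : QCDLatticeObservable Nf R'),
          (∃ g : Literature.MathematicalPhysics.QuantumLattice.LGConfig 4
              (Matrix.specialUnitaryGroup (Fin 3) ℂ) → ℂ, ∀ U, A.F U = algebraMap ℂ _ (g U)) →
          (∃ g : Literature.MathematicalPhysics.QuantumLattice.LGConfig 4
              (Matrix.specialUnitaryGroup (Fin 3) ℂ) → ℂ, ∀ U, B.F U = algebraMap ℂ _ (g U)) →
          ∃ C : ℝ, ∀ᶠ k in atTop, ∀ S : ℕ, (reg.scheme m 0 0).L k ≤ S → ∀ n : ℕ, n ≤ S →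
            ‖qcdLatticeConnectedCorr ((reg.scheme m 0 0).β k) (2 * S + 1)
                (fun fl => (reg.scheme m 0 0).mq fl k) A B n‖ ≤
              C * Real.exp (-(Δ' * ((reg.scheme m 0 0).a k * n))) := by
  sorry

/-- **T2 — massive valence lines (piece `GapTransferR3`, stub 2 of 2).** Along the same schemes,
tied admissible data with a dilute tail and a gap `Δ' > 0` of SIGNED lattice QCD on quark-free
observables upgrade to QCD's full `HasLatticeMassGap Δ''` for some `Δ'' ∈ (0, Δ']` — all
gauge-invariant local observables with quark content (mesons, baryons, their products with loops).
Mechanism: Wick-contract the boxed quark polynomials; under the signed measure `det D · D⁻¹ = adj D`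
is polynomial, and with the admissible filter the propagators are the bounded, strictly finite-range
polynomials `q_f(H_f)² H_f γ₅` up to tail defects, so hadron correlators become gluonic correlators
of quasi-local functionals plus dilute-defect corrections. Why it might fail: at supercritical
hopping (`m_f(k) < 0` on the honest line) `D_W` is not configuration-wise coercive — exceptional
configurations carry long-range quark propagation, and tail-rarity is known under `μ^bos` only, so
moment bounds for `adj D` under the signed measure are needed (Banks–Casher-type obstruction at
`m → 0`). Size: L–XL. -/
theorem stub_valenceLines :
    ∀ (Nf : ℕ) (reg : QCDRegularisation Nf) (m : Fin Nf → ℝ) (ε δ p : ℕ → ℝ) (ℓ : ℕ → ℕ)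
      (κ : ℕ → Fin Nf → ℝ) (ν : ℕ → Fin Nf → List ℂ) (Δ' : ℝ),
      Nf = 2 ∨ Nf = 3 → reg.HasMassScaling → (reg.scheme 0 0 0).HasAsymptoticScaling →
      (∀ f, 0 < m f) → (∀ f, ∀ᶠ k in atTop, -1 < (reg.scheme m 0 0).mq f k) →
      IsAdmissibleMultibosonDataR (reg.scheme m 0 0) ε δ ℓ κ ν →
      Tendsto (fun k => δ k / reg.a k ^ 2) atTop (nhds 0) →
      HasSpectralTailDomination (reg.scheme m 0 0) ε p ℓ ν → 0 < Δ' →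
      (∀ (R R' : ℕ) (A : QCDLatticeObservable Nf R) (B : QCDLatticeObservable Nf R'),
          (∃ g : Literature.MathematicalPhysics.QuantumLattice.LGConfig 4
              (Matrix.specialUnitaryGroup (Fin 3) ℂ) → ℂ, ∀ U, A.F U = algebraMap ℂ _ (g U)) →
          (∃ g : Literature.MathematicalPhysics.QuantumLattice.LGConfig 4
              (Matrix.specialUnitaryGroup (Fin 3) ℂ) → ℂ, ∀ U, B.F U = algebraMap ℂ _ (g U)) →
          ∃ C : ℝ, ∀ᶠ k in atTop, ∀ S : ℕ, (reg.scheme m 0 0).L k ≤ S → ∀ n : ℕ, n ≤ S →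
            ‖qcdLatticeConnectedCorr ((reg.scheme m 0 0).β k) (2 * S + 1)
                (fun fl => (reg.scheme m 0 0).mq fl k) A B n‖ ≤
              C * Real.exp (-(Δ' * ((reg.scheme m 0 0).a k * n)))) →
      ∃ Δ'' : ℝ, 0 < Δ'' ∧ Δ'' ≤ Δ' ∧ (reg.scheme m 0 0).HasLatticeMassGap Δ'' := by
  sorry

/-! ### Compositions (kernel-checked, no sorry; the stubs enter BY NAME) -/

/-- Piece 1 (`MultibosonLatticeGapR4`, stmt-QuantumFields-17617) from S1 and S2: instantiate S2 at the
witnesses of S1. [folklore] -/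
theorem multibosonLatticeGapR4_of_stubs : MultibosonLatticeGapR4 := by
  intro Nf hNf
  obtain ⟨reg, hms, has, hchi, hall⟩ := stub_chiralDiluteLine Nf hNf
  refine ⟨reg, hms, has, hchi, fun m hm => ?_⟩
  obtain ⟨hbr, ε, δ, p, ℓ, κ, ν, hAdm, hRate, hTail⟩ := hall m hm
  obtain ⟨Δ, hΔ, hGap⟩ :=
    stub_gapOfDiluteTail Nf reg m ε δ p ℓ κ ν hNf hms has hm hbr hAdm hRate hTail
  exact ⟨hbr, ε, δ, p, ℓ, κ, ν, hAdm, hRate, hTail, Δ, hΔ, hGap⟩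

/-- Piece 2 (`GapTransferR3`, stmt-QuantumFields-11439) from T1 and T2: sea transfer to the gluonic signed
gap `Δ' ≤ Δ`, then valence upgrade to the full gap `Δ'' ≤ Δ'`. [folklore] -/
theorem gapTransferR3_of_stubs : GapTransferR3 := by
  intro Nf reg m ε δ p ℓ κ ν Δ hNf hms has hm hbr hAdm hRate hTail hΔ hGap
  obtain ⟨Δ', hΔ', hle', hGlue⟩ :=
    stub_seaTransfer Nf reg m ε δ p ℓ κ ν Δ hNf hms has hm hbr hAdm hRate hTail hΔ hGap
  obtain ⟨Δ'', hΔ'', hle'', hFull⟩ :=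
    stub_valenceLines Nf reg m ε δ p ℓ κ ν Δ' hNf hms has hm hbr hAdm hRate hTail hΔ' hGlue
  exact ⟨Δ'', hΔ'', hle''.trans hle', hFull⟩

/-- **The line's concluding composition** — the crux
`Summit.QuantumFields.QCD.Theses.MultibosonBridge.FullLatticeGapC` (by name) from the four stubs: the split
glue (construction + transfer; same proof as the planner's `Split.lean` / the future Theorems file
`MultibosonBridgeFullLatticeGapCSplit`, `fullLatticeGapC_of_subs`) applied to the two piece compositions.
[folklore] -/
theorem FullLatticeGapC_of : Summit.QuantumFields.QCD.Theses.MultibosonBridge.FullLatticeGapC := by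
  intro Nf hNf
  obtain ⟨reg, hms, has, hchi, hall⟩ := multibosonLatticeGapR4_of_stubs Nf hNf
  refine ⟨reg, hms, has, hchi, fun m hm => ?_⟩
  obtain ⟨hbr, ε, δ, p, ℓ, κ, ν, hAdm, hRate, hTail, Δ, hΔ, hGap⟩ := hall m hm
  obtain ⟨Δ', hΔ', -, hGap'⟩ :=
    gapTransferR3_of_stubs Nf reg m ε δ p ℓ κ ν Δ hNf hms has hm hbr hAdm hRate hTail hΔ hGap
  exact ⟨hbr, Δ', hΔ', hGap'⟩

/-! ### Hypothesis forms (documentation of the two-level structure; not the registered composition) -/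

/-- The split glue in hypothesis form: `MultibosonLatticeGapR4 → GapTransferR3 → FullLatticeGapC`
(= `fullLatticeGapC_of_subs` of the planner's `Split.lean`). [folklore] -/
theorem fullLatticeGapC_of_pieces (hM : MultibosonLatticeGapR4) (hG : GapTransferR3) :
    Summit.QuantumFields.QCD.Theses.MultibosonBridge.FullLatticeGapC := by
  intro Nf hNf
  obtain ⟨reg, hms, has, hchi, hall⟩ := hM Nf hNf
  refine ⟨reg, hms, has, hchi, fun m hm => ?_⟩
  obtain ⟨hbr, ε, δ, p, ℓ, κ, ν, hAdm, hRate, hTail, Δ, hΔ, hGap⟩ := hall m hm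
  obtain ⟨Δ', hΔ', -, hGap'⟩ :=
    hG Nf reg m ε δ p ℓ κ ν Δ hNf hms has hm hbr hAdm hRate hTail hΔ hGap
  exact ⟨hbr, Δ', hΔ', hGap'⟩

end Summit.QuantumFields.QCD.Cruxes.FullLatticeGapC.MultibosonSplit
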